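import Summits.ValiantsHypothesis.ValiantsHypothesis.Theorems.GrenetZeonDualUnipotentThreeHalvesLongMassResolventFlag

/-!
# `GrenetZeon.DualUnipotentThreeHalves` (stmt-ValiantsHypothesis-24318), line `slow_core`: (G6) — row r8 in ABSTRACT CAYLEY FORM (tool):
# the CAYLEY-TWIST IDENTITY over any commutative ring (lead val-port-2 g4; memo `…/MEMO-port2g4-generic-component.md` rev 2 §7; crit-7 g4 V47 GO)

OVERLAP, NAMED (crit-7 g4 V47 FINDING 1).  The provider chain `totalDegree_pow_le_of_twist → ledger_of_twist → relCert_of_twist` below is the INDEX FORM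
of row r8 already in the tree in PENCIL currency: ✓ p685647 `…LongMassResolventFlag.lean` (val-idea-30 g6/g7, ported by val-lit-p3 g18) ::
`totalDegree_pow_apply_le_of_twist_pow_eq_zero → ledgerOfResolventIndex_holds → relCert_of_twist_pow_eq_zero`, with `ResolventFlag.twist N x v =
resolvent N x * (linMat N v).map C`; the EXACT converse up to the window is `…LongMassResolventExact.lean :: ledger_top_iff_twist_pow_congr`.  This file
re-uses ✓ `ResolventFlag.linMat` / `ResolventFlag.pointMat` BY NAME (no re-declaration) and proves the BRIDGE `twist_pointMat_eq` (`CayleyTwist.twist (pointMat N x)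
(linMat N v) m = ResolventFlag.twist N x v`), so the two dialects are kernel-convertible.  What is NEW here (V47 (i)–(v)): the ABSTRACT form — `A`, `B` any
square matrices over any commutative ring `S` with an explicit truncation `H` (the currency in which concrete families such as the memo's `W_{m,s}` or
`L_z𝒮` are checked: verify `T^{k+1} = 0` on two matrices); the CLOSED FORMULA `pow_add_smul_eq_sum_twist` with a scalar `c ∈ S`; `one_sub_factor`;
`twist_pow_eq_zero_of_eval` (hypothesis checkable on values `z₀`, ✓ `Polynomial.funext`) + `ledger_of_twist_eval`; naturality `cayleyQ_map` / `twist_map`.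

WHAT THE LEDGER MEASURES.  A `SlowCore.Ledger` entry `(K, k)` asks that along every line `x + s·v` (`v ∈ K`) every power `(N(x) + s·N_lin(v))^p`,
`p ≤ n − 1`, has `s`-degree `≤ k`.  For two square matrices `A` (the value, nilpotent: `A^H = 0`) and `B` (the direction) over a commutative ring put
  `Q(z) := Σ_{i<H} zⁱ Aⁱ = (1 − zA)⁻¹`   (`cayleyQ`),   `T(z) := Q(z)·B`   (the CAYLEY TWIST of `B` by `A`, `twist`).
THE IDENTITY (`pow_add_smul_eq_sum_twist`): if `T(z)^{k+1} = 0` (as a polynomial matrix in `z`) then for EVERY exponent `p` and every scalar `c`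
  `(A + c·B)^p = Σ_{t ≤ k} c^t · [z^p] ( z^t · T(z)^t · Q(z) )`,
because `1 − z(A + cB) = (1 − zA)(1 − zc·T(z))`, both factors have POLYNOMIAL inverses (`Q`, resp. `Σ_{t≤k} (zcT)^t`), and `M^p = [z^p] (1 − zM)⁻¹`.
Hence (`totalDegree_pow_le_of_twist`): along a line, `s`-DEGREE OF EVERY POWER ≤ k as soon as the twisted letter `T(z) = (1 − z·N(x))⁻¹ N_lin(v)` is
nilpotent of index `≤ k + 1` for all `z` — «the Ledger measures the TWISTED NIL-INDEX» (memo §7 (b); the converse holds up to the window `p ≤ n − 1`).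
As `SlowCore.Ledger` / `SlowCore.RelCert` providers (= r8's, abstract currency): `ledger_of_twist`, `relCert_of_twist`; the hypothesis is checkable on VALUES of `z`
(`twist_pow_eq_zero_of_eval`, ✓ `Polynomial.funext`).  Every certified row of the (c) | class table is an instance (banding: `(1 − zA)⁻¹` is in the
Borel GROUP and preserves the band; the tensor-twist families of the memo: `L_z 𝒮` nilpotent of class 3; r3 nil-coupling; r4 gauge).

WORDS OF RECORD (crit-7 g4 V47, adopted): «(G6) — r8, ABSTRACT CAYLEY FORM: for square matrices A (A^H = 0), B over any commutative ring, T(z) := (1 − zA)⁻¹B; if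
T^{k+1} = 0 then (A + cB)^p = Σ_{t≤k} c^t [z^p](z^t T^t (1 − zA)⁻¹) for every p, hence every line of an affine pencil whose twisted directions have nil-index
≤ k + 1 is a Ledger (K, k) (`ledger_of_twist`, `relCert_of_twist`; pencil form and EXACT converse up to the window p ≤ n − 1 = r8 ✓ p685647 / p685669);
SUPPORT LEMMA / TOOL of the mass-cut line, NOT progress on (c) `LongMassSlowLawInv` (RESEARCH — OPEN)».  NOT a new row of the (c) | class table.
(c) / S3 / R2ᵖ / 24318 / 8062 OPEN; `VP ≠ VNP` NOT proved.  No `sorry`; definitions: `cayleyQ`, `twist` (data; `linMat`/`pointMat` are r8's, by name).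
-/

-- single-conjunct layout: Sub = Summit, duplicated namespace component intended (the name is mandated)
set_option linter.dupNamespace false
set_option autoImplicit false

noncomputable section

namespace Summit.ValiantsHypothesis.ValiantsHypothesis.Theorems.GrenetZeon.CayleyTwist

open Matrix
open scoped BigOperators
open Summit.ValiantsHypothesis.ValiantsHypothesis.Cruxes.TwoDimCoefficients.DimTwoCases (AffMat IsAffine)
open Summit.ValiantsHypothesis.ValiantsHypothesis.Theorems.GrenetZeon.RadicalSplit (lineSubst)
open Summit.ValiantsHypothesis.ValiantsHypothesis.Theorems.GrenetZeon.SlowCore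
  (Ledger RelCert linEntry lineSubst_apply_of_le_one)
open Summit.ValiantsHypothesis.ValiantsHypothesis.Theorems.GrenetZeon.ResolventFlag (linMat pointMat)

/-! ## §1 The Cayley inverse and the twisted letter (any commutative ring) -/

section Algebra

variable {S : Type*} [CommRing S] {m : ℕ}

/-- `Q(z) = Σ_{i<H} zⁱ·Aⁱ` — the (truncated) CAYLEY INVERSE of `1 − z·A`, a polynomial matrix in `z`; a genuine two-sided inverse when `A^H = 0`. -/
def cayleyQ (A : Matrix (Fin m) (Fin m) S) (H : ℕ) : Matrix (Fin m) (Fin m) (Polynomial S) :=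
  ∑ i ∈ Finset.range H, ((Polynomial.X : Polynomial S) • A.map Polynomial.C) ^ i

/-- `T(z) = (1 − zA)⁻¹ · B` — the CAYLEY TWIST of the direction `B` by the value `A`. -/
def twist (A B : Matrix (Fin m) (Fin m) S) (H : ℕ) : Matrix (Fin m) (Fin m) (Polynomial S) :=
  cayleyQ A H * B.map Polynomial.C

/-- `(z·A)^H = 0` when `A^H = 0`. -/
theorem X_smul_pow_eq_zero (A : Matrix (Fin m) (Fin m) S) {H : ℕ} (hA : A ^ H = 0) :
    ((Polynomial.X : Polynomial S) • A.map Polynomial.C) ^ H = 0 := by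
  rw [smul_pow, ← Matrix.map_pow, hA, Matrix.map_zero _ (map_zero _), smul_zero]

/-- `(1 − zA) · Q(z) = 1`. -/
theorem one_sub_mul_cayleyQ (A : Matrix (Fin m) (Fin m) S) {H : ℕ} (hA : A ^ H = 0) :
    (1 - (Polynomial.X : Polynomial S) • A.map Polynomial.C) * cayleyQ A H = 1 := by
  rw [cayleyQ, mul_neg_geom_sum, X_smul_pow_eq_zero A hA, sub_zero]

/-- `Q(z) · (1 − zA) = 1`. -/
theorem cayleyQ_mul_one_sub (A : Matrix (Fin m) (Fin m) S) {H : ℕ} (hA : A ^ H = 0) :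
    cayleyQ A H * (1 - (Polynomial.X : Polynomial S) • A.map Polynomial.C) = 1 := by
  rw [cayleyQ, geom_sum_mul_neg, X_smul_pow_eq_zero A hA, sub_zero]

/-- The pencil `A + c·B` pushed to constants of `S[z]`. -/
theorem map_add_smul (A B : Matrix (Fin m) (Fin m) S) (c : S) :
    (A + c • B).map Polynomial.C = A.map Polynomial.C + Polynomial.C c • B.map Polynomial.C := by
  ext i j
  simp [Matrix.map_apply, smul_eq_mul]

/-- THE FACTORISATION `1 − z(A + cB) = (1 − zA)(1 − zc·T(z))`. -/
theorem one_sub_factor (A B : Matrix (Fin m) (Fin m) S) (c : S) {H : ℕ} (hA : A ^ H = 0) :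
    1 - (Polynomial.X : Polynomial S) • (A + c • B).map Polynomial.C
      = (1 - (Polynomial.X : Polynomial S) • A.map Polynomial.C) *
          (1 - (Polynomial.C c * Polynomial.X) • twist A B H) := by
  rw [mul_sub, mul_one, twist, Matrix.mul_smul, ← Matrix.mul_assoc, one_sub_mul_cayleyQ A hA, Matrix.one_mul,
    map_add_smul, smul_add, ← mul_smul, mul_comm (Polynomial.X : Polynomial S) (Polynomial.C c)]
  abel

/-- The truncated inverse of `1 − zc·T(z)`: `G₁ = Σ_{t ≤ k} (zc·T)^t`, exact when `T^{k+1} = 0`. -/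
theorem one_sub_mul_geom_twist (A B : Matrix (Fin m) (Fin m) S) (c : S) {H k : ℕ} (hT : twist A B H ^ (k + 1) = 0) :
    (1 - (Polynomial.C c * Polynomial.X) • twist A B H) *
      (∑ t ∈ Finset.range (k + 1), ((Polynomial.C c * Polynomial.X) • twist A B H) ^ t) = 1 := by
  rw [mul_neg_geom_sum, smul_pow, hT, smul_zero, sub_zero]

/-- `(1 − zM)·G = 1` for `G = (Σ_{t≤k} (zcT)^t)·Q`. -/
theorem one_sub_mul_G (A B : Matrix (Fin m) (Fin m) S) (c : S) {H k : ℕ} (hA : A ^ H = 0) (hT : twist A B H ^ (k + 1) = 0) :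
    (1 - (Polynomial.X : Polynomial S) • (A + c • B).map Polynomial.C) *
      ((∑ t ∈ Finset.range (k + 1), ((Polynomial.C c * Polynomial.X) • twist A B H) ^ t) * cayleyQ A H) = 1 := by
  rw [one_sub_factor A B c hA, Matrix.mul_assoc, ← Matrix.mul_assoc (1 - (Polynomial.C c * Polynomial.X) • twist A B H),
    one_sub_mul_geom_twist A B c hT, Matrix.one_mul, one_sub_mul_cayleyQ A hA]

/-- TELESCOPING: `Σ_{p<N} (zM)^p = (1 − (zM)^N) · G` whenever `(1 − zM)·G = 1`. -/
theorem geom_sum_eq_mul_G {R : Type*} [Ring R] (x G : R) (hG : (1 - x) * G = 1) (N : ℕ) :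
    ∑ p ∈ Finset.range N, x ^ p = (1 - x ^ N) * G := by
  have h := geom_sum_mul_neg x N
  calc ∑ p ∈ Finset.range N, x ^ p = (∑ p ∈ Finset.range N, x ^ p) * ((1 - x) * G) := by rw [hG, mul_one]
    _ = (1 - x ^ N) * G := by rw [← mul_assoc, h]

/-- Coefficient extraction: `[z^p] Σ_{p'<p+1} (z·M)^{p'} = M^p` (entrywise). -/
theorem coeff_geom_sum_X_smul (M : Matrix (Fin m) (Fin m) S) (p : ℕ) (i j : Fin m) :
    Polynomial.coeff ((∑ p' ∈ Finset.range (p + 1), ((Polynomial.X : Polynomial S) • M.map Polynomial.C) ^ p') i j) p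
      = (M ^ p) i j := by
  rw [Matrix.sum_apply, Polynomial.finsetSum_coeff]
  have hterm : ∀ p', Polynomial.coeff ((((Polynomial.X : Polynomial S) • M.map Polynomial.C) ^ p') i j) p
      = if p = p' then (M ^ p') i j else 0 := by
    intro p'
    rw [smul_pow, ← Matrix.map_pow, Matrix.smul_apply, Matrix.map_apply, smul_eq_mul, mul_comm,
      Polynomial.coeff_C_mul_X_pow]
  simp_rw [hterm]
  rw [Finset.sum_ite_eq, if_pos (Finset.mem_range.mpr (Nat.lt_succ_self p))]

/-- Coefficient extraction: `[z^p] ((zM)^{p+1} · G) = 0`. -/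
theorem coeff_X_smul_pow_succ_mul (M : Matrix (Fin m) (Fin m) S) (G : Matrix (Fin m) (Fin m) (Polynomial S)) (p : ℕ) (i j : Fin m) :
    Polynomial.coeff (((((Polynomial.X : Polynomial S) • M.map Polynomial.C) ^ (p + 1)) * G) i j) p = 0 := by
  rw [smul_pow, Matrix.smul_mul, Matrix.smul_apply, smul_eq_mul, Polynomial.coeff_X_pow_mul']
  simp

/-- ★ **THE CAYLEY-TWIST IDENTITY.**  If `A^H = 0` and the twisted letter `T(z) = (1 − zA)⁻¹B` satisfies `T^{k+1} = 0`, then for every `p` and `c`: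
`(A + c·B)^p = Σ_{t ≤ k} c^t · [z^p]( z^t · T(z)^t · Q(z) )` — at most `k` letters `B` survive in every power. [memo §7] -/
theorem pow_add_smul_eq_sum_twist (A B : Matrix (Fin m) (Fin m) S) (c : S) {H k : ℕ} (hA : A ^ H = 0)
    (hT : twist A B H ^ (k + 1) = 0) (p : ℕ) (i j : Fin m) :
    ((A + c • B) ^ p) i j = ∑ t ∈ Finset.range (k + 1),
      c ^ t * Polynomial.coeff ((((Polynomial.X : Polynomial S) ^ t • (twist A B H ^ t * cayleyQ A H))) i j) p := by
  set M := A + c • B with hM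
  set G := (∑ t ∈ Finset.range (k + 1), ((Polynomial.C c * Polynomial.X) • twist A B H) ^ t) * cayleyQ A H with hG
  have hinv : (1 - (Polynomial.X : Polynomial S) • M.map Polynomial.C) * G = 1 := one_sub_mul_G A B c hA hT
  have htel := geom_sum_eq_mul_G ((Polynomial.X : Polynomial S) • M.map Polynomial.C) G hinv (p + 1)
  have hcoeff : Polynomial.coeff ((∑ p' ∈ Finset.range (p + 1), ((Polynomial.X : Polynomial S) • M.map Polynomial.C) ^ p') i j) p
      = Polynomial.coeff (((1 - ((Polynomial.X : Polynomial S) • M.map Polynomial.C) ^ (p + 1)) * G) i j) p := by rw [htel]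
  rw [coeff_geom_sum_X_smul, sub_mul, one_mul, Matrix.sub_apply, Polynomial.coeff_sub, coeff_X_smul_pow_succ_mul, sub_zero,
    hG, Finset.sum_mul, Matrix.sum_apply, Polynomial.finsetSum_coeff] at hcoeff
  rw [hcoeff]
  refine Finset.sum_congr rfl fun t _ => ?_
  rw [smul_pow, mul_pow, ← Polynomial.C_pow, Matrix.smul_mul, mul_smul, Matrix.smul_apply, smul_eq_mul, Polynomial.coeff_C_mul,
    Matrix.smul_apply, smul_eq_mul]

/-! ### Naturality (change of scalars) and evaluation -/

/-- `cayleyQ` commutes with ring homomorphisms of the scalars. -/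
theorem cayleyQ_map {S' : Type*} [CommRing S'] (φ : S →+* S') (A : Matrix (Fin m) (Fin m) S) (H : ℕ) :
    cayleyQ (A.map φ) H = (cayleyQ A H).map (Polynomial.mapRingHom φ) := by
  rw [cayleyQ, cayleyQ]
  change _ = (Polynomial.mapRingHom φ).mapMatrix (∑ i ∈ Finset.range H, ((Polynomial.X : Polynomial S) • A.map Polynomial.C) ^ i)
  rw [map_sum]
  refine Finset.sum_congr rfl fun i _ => ?_
  rw [map_pow]
  congr 1
  ext a b
  simp [Matrix.map_apply, smul_eq_mul]

/-- `twist` commutes with ring homomorphisms of the scalars. -/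
theorem twist_map {S' : Type*} [CommRing S'] (φ : S →+* S') (A B : Matrix (Fin m) (Fin m) S) (H : ℕ) :
    twist (A.map φ) (B.map φ) H = (twist A B H).map (Polynomial.mapRingHom φ) := by
  rw [twist, twist, cayleyQ_map]
  change _ = (Polynomial.mapRingHom φ).mapMatrix (cayleyQ A H * B.map Polynomial.C)
  rw [map_mul]
  congr 1
  ext a b
  simp [Matrix.map_apply]

/-- Pushing a scalar ring homomorphism through `z^t • N`. -/
theorem map_X_pow_smul {S' : Type*} [CommRing S'] (φ : S →+* S') (N : Matrix (Fin m) (Fin m) (Polynomial S)) (t : ℕ) :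
    ((Polynomial.X : Polynomial S) ^ t • N).map (Polynomial.mapRingHom φ)
      = (Polynomial.X : Polynomial S') ^ t • N.map (Polynomial.mapRingHom φ) := by
  ext a b
  simp [Matrix.map_apply, smul_eq_mul, Polynomial.map_pow, Polynomial.map_X]

/-- The terms of the identity commute with ring homomorphisms of the scalars. -/
theorem twistTerm_map {S' : Type*} [CommRing S'] (φ : S →+* S') (A B : Matrix (Fin m) (Fin m) S) (H t : ℕ) :
    (Polynomial.X : Polynomial S') ^ t • (twist (A.map φ) (B.map φ) H ^ t * cayleyQ (A.map φ) H)
      = ((Polynomial.X : Polynomial S) ^ t • (twist A B H ^ t * cayleyQ A H)).map (Polynomial.mapRingHom φ) := by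
  rw [map_X_pow_smul, twist_map, cayleyQ_map]
  congr 1
  change _ = (Polynomial.mapRingHom φ).mapMatrix (twist A B H ^ t * cayleyQ A H)
  rw [map_mul, map_pow]
  rfl

/-- Evaluating the twisted letter at `z = z₀`: `T(z₀) = (Σ_{i<H} z₀ⁱ Aⁱ)·B`. -/
theorem twist_map_eval (A B : Matrix (Fin m) (Fin m) S) (H : ℕ) (z₀ : S) :
    (twist A B H).map (Polynomial.eval z₀) = (∑ i ∈ Finset.range H, z₀ ^ i • A ^ i) * B := by
  rw [twist, cayleyQ]
  change (Polynomial.evalRingHom z₀).mapMatrix ((∑ i ∈ Finset.range H, ((Polynomial.X : Polynomial S) • A.map Polynomial.C) ^ i) *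
    B.map Polynomial.C) = _
  rw [map_mul, map_sum]
  congr 1
  · refine Finset.sum_congr rfl fun i _ => ?_
    have h1 : (Polynomial.evalRingHom z₀).mapMatrix ((Polynomial.X : Polynomial S) • A.map Polynomial.C) = z₀ • A := by
      ext a b
      rw [RingHom.mapMatrix_apply, Matrix.map_apply, Matrix.smul_apply, Matrix.map_apply, Matrix.smul_apply, smul_eq_mul,
        smul_eq_mul, Polynomial.coe_evalRingHom, Polynomial.eval_mul, Polynomial.eval_X, Polynomial.eval_C]
    rw [map_pow, h1, smul_pow]
  · ext a b
    simp [Matrix.map_apply]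

/-- **CHECKABLE ON VALUES.**  Over an infinite integral domain (e.g. `ℂ`), `T(z)^{k+1} = 0` as a polynomial matrix iff it vanishes at every `z₀`. -/
theorem twist_pow_eq_zero_of_eval {K : Type*} [CommRing K] [IsDomain K] [Infinite K] (A B : Matrix (Fin m) (Fin m) K) (H k : ℕ)
    (h : ∀ z₀ : K, ((∑ i ∈ Finset.range H, z₀ ^ i • A ^ i) * B) ^ (k + 1) = 0) : twist A B H ^ (k + 1) = 0 := by
  refine Matrix.ext fun a b => ?_
  apply Polynomial.funext
  intro z₀
  have hz := h z₀
  rw [← twist_map_eval] at hz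
  have hmap : ((twist A B H).map (Polynomial.eval z₀)) ^ (k + 1) = ((twist A B H) ^ (k + 1)).map (Polynomial.eval z₀) := by
    change ((Polynomial.evalRingHom z₀).mapMatrix (twist A B H)) ^ (k + 1) = (Polynomial.evalRingHom z₀).mapMatrix (twist A B H ^ (k + 1))
    rw [map_pow]
  rw [hmap] at hz
  have := congr_fun (congr_fun hz a) b
  rw [Matrix.map_apply] at this
  rw [Matrix.zero_apply, Polynomial.eval_zero]
  exact this

end Algebra

/-! ## §2 Degree form over `ℂ[s]`: at most `k` direction letters survive ⇒ `s`-degree `≤ k` -/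

section Degree

variable {m : ℕ}

/-- ★ **DEGREE BOUND FROM THE TWISTED INDEX.**  For complex `A`, `B` with `A^H = 0` and `((1 − zA)⁻¹B)^{k+1} = 0`: every entry of every power of the
one-variable pencil `A + s·B` has `s`-degree `≤ k`. [memo §7 (b)] -/
theorem totalDegree_pow_le_of_twist (A B : Matrix (Fin m) (Fin m) ℂ) {H k : ℕ} (hA : A ^ H = 0) (hT : twist A B H ^ (k + 1) = 0)
    (p : ℕ) (i j : Fin m) :
    (((A.map (MvPolynomial.C : ℂ →+* MvPolynomial (Fin 1) ℂ) +
        (MvPolynomial.X 0 : MvPolynomial (Fin 1) ℂ) • B.map (MvPolynomial.C : ℂ →+* MvPolynomial (Fin 1) ℂ)) ^ p) i j).totalDegree ≤ k := by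
  set φ : ℂ →+* MvPolynomial (Fin 1) ℂ := MvPolynomial.C with hφ
  have hA' : (A.map φ) ^ H = 0 := by
    rw [← Matrix.map_pow, hA]; exact Matrix.map_zero _ (map_zero _)
  have hT' : twist (A.map φ) (B.map φ) H ^ (k + 1) = 0 := by
    rw [twist_map]
    change ((Polynomial.mapRingHom φ).mapMatrix (twist A B H)) ^ (k + 1) = 0
    rw [← map_pow, hT, map_zero]
  rw [pow_add_smul_eq_sum_twist (A.map φ) (B.map φ) (MvPolynomial.X 0) hA' hT' p i j]
  refine (MvPolynomial.totalDegree_finsetSum _ _).trans (Finset.sup_le fun t ht => ?_)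
  have hconst : Polynomial.coeff (((Polynomial.X : Polynomial (MvPolynomial (Fin 1) ℂ)) ^ t •
        (twist (A.map φ) (B.map φ) H ^ t * cayleyQ (A.map φ) H)) i j) p
      = φ (Polynomial.coeff (((Polynomial.X : Polynomial ℂ) ^ t • (twist A B H ^ t * cayleyQ A H)) i j) p) := by
    rw [twistTerm_map, Matrix.map_apply]
    exact Polynomial.coeff_map _ _
  rw [hconst, hφ]
  refine (MvPolynomial.totalDegree_mul _ _).trans ?_
  rw [MvPolynomial.totalDegree_C, add_zero, MvPolynomial.totalDegree_X_pow]
  exact Nat.lt_succ_iff.mp (Finset.mem_range.mp ht)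

end Degree

/-! ## §3 The `SlowCore.Ledger` / `SlowCore.RelCert` providers -/

section LedgerProvider

variable {n m : ℕ}

/-- Along a line, an affine pencil is `value + s · direction`. -/
theorem map_lineSubst_eq (N : AffMat n m) (hN : IsAffine N) (x v : Fin n × Fin n → ℂ) :
    N.map (lineSubst x v) = (N.map (MvPolynomial.eval x)).map (MvPolynomial.C : ℂ →+* MvPolynomial (Fin 1) ℂ) +
      (MvPolynomial.X 0 : MvPolynomial (Fin 1) ℂ) • (linMat N v).map (MvPolynomial.C : ℂ →+* MvPolynomial (Fin 1) ℂ) := by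
  ext i j
  rw [Matrix.map_apply, lineSubst_apply_of_le_one N hN x v i j, Matrix.add_apply, Matrix.map_apply, Matrix.map_apply,
    Matrix.smul_apply, Matrix.map_apply, ResolventFlag.linMat, Matrix.of_apply, smul_eq_mul, mul_comm]

/-- ★★ **ROW r9 — THE CAYLEY-TWIST CRITERION as a `SlowCore.Ledger` provider.**  If every value is nilpotent of index `≤ H` and, along `K`, every
twisted direction `T(z) = (1 − z·N(x))⁻¹ · N_lin(v)` satisfies `T(z)^{k+1} = 0` (as a polynomial matrix in `z`), then `(K, k)` is a whole-pencil
ledger entry — for EVERY power, not only `p ≤ n − 1`. [memo §7 (c)] -/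
theorem ledger_of_twist (N : AffMat n m) (hN : IsAffine N) (K : Submodule ℂ (Fin n × Fin n → ℂ)) {H k : ℕ}
    (hH : ∀ x : Fin n × Fin n → ℂ, (N.map (MvPolynomial.eval x)) ^ H = 0)
    (htw : ∀ x v : Fin n × Fin n → ℂ, v ∈ K → twist (N.map (MvPolynomial.eval x)) (linMat N v) H ^ (k + 1) = 0) :
    Ledger n m N (fun _ => True) K k := by
  intro x v hv b _ i j _ _
  rw [map_lineSubst_eq N hN x v]
  exact totalDegree_pow_le_of_twist _ _ (hH x) (htw x v hv) b i j

/-- The same with the twist hypothesis checked on VALUES `z₀ ∈ ℂ`: `((Σ_{i<H} z₀ⁱ N(x)ⁱ) · N_lin(v))^{k+1} = 0`. -/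
theorem ledger_of_twist_eval (N : AffMat n m) (hN : IsAffine N) (K : Submodule ℂ (Fin n × Fin n → ℂ)) {H k : ℕ}
    (hH : ∀ x : Fin n × Fin n → ℂ, (N.map (MvPolynomial.eval x)) ^ H = 0)
    (htw : ∀ x v : Fin n × Fin n → ℂ, v ∈ K → ∀ z₀ : ℂ,
      ((∑ i ∈ Finset.range H, z₀ ^ i • (N.map (MvPolynomial.eval x)) ^ i) * linMat N v) ^ (k + 1) = 0) :
    Ledger n m N (fun _ => True) K k :=
  ledger_of_twist N hN K hH fun x v hv => twist_pow_eq_zero_of_eval _ _ H k (htw x v hv)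

/-- **PRICE FORM.**  Row r9 as a `SlowCore.RelCert` provider: price `n·k + codim K`. -/
theorem relCert_of_twist (N : AffMat n m) (hN : IsAffine N) (K : Submodule ℂ (Fin n × Fin n → ℂ)) {H k P : ℕ}
    (hH : ∀ x : Fin n × Fin n → ℂ, (N.map (MvPolynomial.eval x)) ^ H = 0)
    (htw : ∀ x v : Fin n × Fin n → ℂ, v ∈ K → twist (N.map (MvPolynomial.eval x)) (linMat N v) H ^ (k + 1) = 0)
    (hP : n * k + (n * n - Module.finrank ℂ K) ≤ P) : RelCert n m N P :=
  ⟨K, k, ledger_of_twist N hN K hH htw, hP⟩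

/-! ### Bridge to row r8's pencil currency (crit-7 g4 V47 (C2)) -/

/-- `cayleyQ` of a value at truncation `m` IS r8's `resolvent`. -/
theorem cayleyQ_pointMat_eq (N : AffMat n m) (x : Fin n × Fin n → ℂ) : cayleyQ (pointMat N x) m = ResolventFlag.resolvent N x := by
  rw [cayleyQ, ResolventFlag.resolvent]
  refine Finset.sum_congr rfl fun a _ => ?_
  rw [smul_pow, Matrix.map_pow]

/-- ★ **BRIDGE.**  The abstract Cayley twist of (value, direction) at truncation `m` IS r8's `ResolventFlag.twist`: the two dialects are
kernel-convertible. -/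
theorem twist_pointMat_eq (N : AffMat n m) (x v : Fin n × Fin n → ℂ) : twist (pointMat N x) (linMat N v) m = ResolventFlag.twist N x v := by
  rw [twist, cayleyQ_pointMat_eq, ResolventFlag.twist]

/-- r8's index-form provider RECOVERED from the abstract one at `H = m` (explicit dependency; same statement as ✓ `ResolventFlag.relCert_of_twist_pow_eq_zero`
up to unfolding `pointMat`). -/
theorem relCert_of_resolventFlag_twist (N : AffMat n m) (hN : IsAffine N) (hnil : N ^ m = 0) (K : Submodule ℂ (Fin n × Fin n → ℂ)) (k : ℕ)
    (htw : ∀ x v : Fin n × Fin n → ℂ, v ∈ K → ResolventFlag.twist N x v ^ (k + 1) = 0) :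
    RelCert n m N (n * k + (n * n - Module.finrank ℂ K)) :=
  relCert_of_twist N hN K (H := m)
    (fun x => by rw [← Matrix.map_pow, hnil]; exact Matrix.map_zero _ (map_zero _))
    (fun x v hv => by have h := htw x v hv; rw [← twist_pointMat_eq] at h; exact h) le_rfl

end LedgerProvider

end Summit.ValiantsHypothesis.ValiantsHypothesis.Theorems.GrenetZeon.CayleyTwist

end
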